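import Literature.AnabelianGeometry.SemiGraphs.PSCRamification
import HarnessLib

/-!
# [CombGC] Theorem 1.6, sub-DAG statements II: the vertex-set characterization of [IUTchI] Rmk. 1.2.3 (iv)

Mochizuki, *Inter-universal Teichmüller theory I*, Remark 1.2.3 (iv), kurims manuscript p. 42 — the
replacement text for [CombGC] Remark 1.4.3, verticial part — and [CombGC] proof of Theorem 1.6 (iii)
as amended by [IUTchI] Remark 1.2.3 (vii) p. 43: "necessity follows formally from the characterization
of unramified verticial subgroups given in Remark 1.4.3 and the characterization of verticially purely
totally ramified finite étale coverings given in Remark 1.4.2".  STATEMENTS-FIRST sub-DAG typing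
(D-0068 (1); cell file plan/L3/SUBDAG-CombGC-Thm16.md rows T16-L13 / T16-L14, writer abc-iut-w4-d052,
cut L3-lead gen 3 ξ3-1) over abc-iut-L3-t4's `PSCRamification.lean` vocabulary (`unrAbKer` = preimage
of `0 ⊆ M^unr_G`, `unrVertAbOf v` = preimage of `M^unr_G[v]`, `IsVerticiallyPurelyTotallyRamified`) and
in the SHAPE of its `ElementaryQuotientVerticiallyRamifiedIff` (an elementary abelian quotient
`φ : M^unr_G ↠ Q` is recorded by its kernel: an open normal `H' ⊇ E^unr_G` with `g^l ∈ H'` for all `g`).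

Typed (predicates ON the datum, geometric-origin content, FALSE for arbitrary data — hence also
bundled over the origin parameter as `…Holds Ω`; nothing asserted):
* `unrVertAb` — preimage of `M^unr-vert_G := Im(⊕_v M^unr_G[v] ↪ M^unr_G)`;
* `IsElemAbUnrQuotient l H'` — "`H'` is the kernel of an elementary abelian quotient of `M^unr_G`";
* `vertexQuotientKer l v` — preimage of `Ker(M^unr-vert_G ↠ M^unr_G[v] ↠ M^unr_G[v] ⊗ F_l)` ("the first
  ↠ is the natural projection [for the split injection]; the second ↠ is given by reduction modulo
  `l`"), i.e. the closed subgroup generated by `E^unr_G`, the `M^unr_G[w]` for `w ≠ v`, and the `l`-th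
  powers of (the preimage of) `M^unr_G[v]`;
* `VertexQuotientCharacterization` — "the elementary abelian quotients `φ : M^unr_G ↠ Q` whose
  restriction to `M^unr-vert_G` surjects onto `Q` and has the same kernel as the quotient
  `M^unr-vert_G ↠ M^unr_G[v] ↠ M^unr_G[v] ⊗ F_l` may be characterized as the maximal quotients [i.e.,
  relative to the relation of domination] among those elementary abelian quotients of `M^unr_G` that
  correspond to verticially purely totally ramified coverings of `G`" (sturdy `G`, `Σ = {l}`);
* `VertexSetCharacterization` — "Thus, since `G` is sturdy, the set of vertices of `G` may be
  characterized as the set of [nontrivial!] quotients `M^unr-vert_G ↠ M^unr_G[v] ⊗ F_l`" (the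
  assignment `v ↦ Ker` is injective and no kernel is everything);
* `UnrVerticialEqVertexStabilizer` (row T16-L14) — "to characterize the unramified verticial subgroups
  of `Π^unr_G`, it suffices — by considering stabilizers of vertices of underlying semi-graphs of finite
  étale `Π^unr_G`-coverings of `G` — to give a functorial characterization of the set of vertices": over
  the interface (vertices of `G_U` over `v` = double cosets `U γ Π_v`, whose stabilizer under left
  translation is `U · γ Π_v γ⁻¹` for normal `U`) the unramified verticial subgroups are exactly the
  stabilizers of compatible systems of vertices, `⋂_{U} (U · γ Π_v γ⁻¹)` over the open normal
  `U ⊇ Ker(Π_G ↠ Π^unr_G)` — a statement PROVABLE for profinite `Π_G` (closed subgroups are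
  intersections of their open-normal neighbourhoods); typed here, proof left to the row's prover.
"Functorial" = the same statements for the coverings `G_U`, which the interface will express through
the covering-datum functor of GAP-LEDGER G-w4d052-1 (not through new statements).  As abc-iut-L3-t4's docstring of
`ElementaryQuotientVerticiallyRamifiedIff` records, the vertex-set description is "the conjunction of
this claim with the split injection": `VertexQuotientCharacterization` / `VertexSetCharacterization`
are expected to be DERIVED in the kernel from `UnrVerticialCharacterizationHolds Ω` (row T16-L13
kernel), and `UnrVerticialEqVertexStabilizer` from profiniteness alone — they are SUB-NODE statements
(targets), NOT FACT-LIST facts (post-freeze: GAP-LEDGER targets); no instance, no notation; typed ≠ proved;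
nothing here takes a side on [IUTchIII] Cor. 3.12.
[cite: Mochizuki2012, IUTchI Rmk 1.2.3(iv) p.42] [cite: MochizukiCombGC2007, Thm 1.6(iii) p.14]
-/

noncomputable section

namespace Literature.AnabelianGeometry.SemiGraphs

namespace PSCDatum

open scoped Pointwise

universe u

variable {P : Type u} [Group P] [TopologicalSpace P] [IsTopologicalGroup P]

/-! ### `M^unr-vert_G`, elementary abelian quotients of `M^unr_G`, and the quotients `M^unr-vert ↠ M^unr[v] ⊗ F_l` -/

/-- The inverse image in `Π_G` of `M^unr-vert_G ⊆ M^unr_G`, "the image [of the split injection]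
`⊕_v M^unr_G[v] ↪ M^unr_G` [where `v` ranges over the vertices of `G`], whose image we denote by
`M^unr-vert_G`" ([IUTchI] Rmk. 1.2.3 (iv), p. 42): the closed subgroup generated by the
`unrVertAbOf v`. [cite: Mochizuki2012, IUTchI Rmk 1.2.3(iv) p.42] -/
def unrVertAb (G : PSCDatum P) : Subgroup P := (⨆ v : G.graph.V, G.unrVertAbOf v).topologicalClosure

/-- "`φ : M^unr_G ↠ Q` — i.e., where `Q` is an elementary abelian group.  We identify such quotients
whenever their kernels coincide" ([IUTchI] Rmk. 1.2.3 (iv), p. 42): an elementary abelian quotient of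
`M^unr_G` RECORDED BY ITS KERNEL in `Π_G` — an open normal subgroup `H' ⊇ E^unr_G` modulo which every
element has order dividing `l` (the shape used by `ElementaryQuotientVerticiallyRamifiedIff`).
"Domination" of quotients is inclusion of these kernels. [cite: Mochizuki2012, IUTchI Rmk 1.2.3(iv) p.42] -/
def IsElemAbUnrQuotient (G : PSCDatum P) (l : ℕ) (H' : Subgroup P) : Prop :=
  H'.Normal ∧ IsOpen (H' : Set P) ∧ G.unrAbKer ≤ H' ∧ ∀ g : P, g ^ l ∈ H'

/-- The inverse image in `Π_G` of the kernel of "the quotient `M^unr-vert_G ↠ M^unr_G[v] ↠ M^unr_G[v] ⊗ F_l`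
— where the first `↠` is the natural projection; the second `↠` is given by reduction modulo `l`"
([IUTchI] Rmk. 1.2.3 (iv), p. 42): the closed subgroup generated by `E^unr_G`, the `M^unr_G[w]` for the
vertices `w ≠ v`, and the `l`-th powers of (the inverse image of) `M^unr_G[v]` (a subgroup of
`unrVertAb`, equal to that kernel's preimage granted the split injection `UnrVerticialSplitInjection`).
[cite: Mochizuki2012, IUTchI Rmk 1.2.3(iv) p.42] -/
def vertexQuotientKer (G : PSCDatum P) (l : ℕ) (v : G.graph.V) : Subgroup P :=
  (G.unrAbKer ⊔ (⨆ w : {w : G.graph.V // w ≠ v}, G.unrVertAbOf w.1) ⊔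
    Subgroup.closure ((fun g : P => g ^ l) '' (G.unrVertAbOf v : Set P))).topologicalClosure

/-! ### [IUTchI] Remark 1.2.3 (iv), verticial part: the characterization of the vertex quotients -/

/-- **[IUTchI] Remark 1.2.3 (iv), displayed characterization**, p. 42, for sturdy `G` of pro-`Σ` PSC-type,
`Σ = {l}`: "the elementary abelian quotients `φ : M^unr_G ↠ Q` whose restriction to `M^unr-vert_G`
surjects onto `Q` [`unrVertAb ⊔ H' = ⊤`] and has the same kernel as the quotient
`M^unr-vert_G ↠ M^unr_G[v] ↠ M^unr_G[v] ⊗ F_l` [`unrVertAb ⊓ H' = vertexQuotientKer l v`] … may be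
characterized as the maximal quotients [i.e., relative to the relation of domination: minimal kernels]
among those elementary abelian quotients of `M^unr_G` that correspond to verticially purely totally
ramified coverings of `G`."  A predicate on the datum, not asserted.
[cite: Mochizuki2012, IUTchI Rmk 1.2.3(iv) p.42] -/
def VertexQuotientCharacterization (G : PSCDatum P) : Prop :=
  G.IsSturdy → ∀ l : ℕ, G.Sigma = {l} → ∀ H' : Subgroup P, G.IsElemAbUnrQuotient l H' →
    ((∃ v : G.graph.V, G.unrVertAb ⊔ H' = ⊤ ∧ G.unrVertAb ⊓ H' = G.vertexQuotientKer l v) ↔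
      (G.IsVerticiallyPurelyTotallyRamified ⊤ H' ∧
        ∀ H'' : Subgroup P, G.IsElemAbUnrQuotient l H'' → G.IsVerticiallyPurelyTotallyRamified ⊤ H'' →
          H'' ≤ H' → H'' = H'))

/-- **[IUTchI] Remark 1.2.3 (iv), conclusion**, p. 42: "Thus, since `G` is sturdy, the set of vertices
of `G` may be characterized as the set of [nontrivial!] quotients `M^unr-vert_G ↠ M^unr_G[v] ⊗ F_l`" —
distinct vertices give distinct quotients and none of them is the trivial quotient (for `Σ = {l}`).
A predicate on the datum, not asserted. [cite: Mochizuki2012, IUTchI Rmk 1.2.3(iv) p.42] -/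
def VertexSetCharacterization (G : PSCDatum P) : Prop :=
  G.IsSturdy → ∀ l : ℕ, G.Sigma = {l} →
    Function.Injective (G.vertexQuotientKer l) ∧ ∀ v : G.graph.V, G.vertexQuotientKer l v ≠ G.unrVertAb

/-! ### Row T16-L14: unramified verticial subgroups as stabilizers of compatible systems of vertices -/

/-- **[IUTchI] Remark 1.2.3 (iv)**, p. 42 ("in order to characterize the unramified verticial subgroups
of `Π^unr_G`, it suffices — by considering stabilizers of vertices of underlying semi-graphs of finite
étale `Π^unr_G`-coverings of `G` — to give a functorial characterization of the set of vertices of `G`"),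
over the interface: the vertices of the `Π^unr_G`-covering `G_U` (`U` open normal, `U ⊇ Ker(Π_G ↠
Π^unr_G)`) lying over `v` are the double cosets `U γ Π_v`, with stabilizer `U · γ Π_v γ⁻¹` under left
translation; the unramified verticial subgroups `Π_v^γ · Ker(Π_G ↠ Π^unr_G)` are EXACTLY the stabilizers
of compatible systems of such vertices, i.e. the intersections `⋂_U (U · γ Π_v γ⁻¹)`.  (Provable for
profinite `Π_G`; typed as the sub-node statement, proof left to the row's prover.)
[cite: Mochizuki2012, IUTchI Rmk 1.2.3(iv) p.42] -/
def UnrVerticialEqVertexStabilizer (G : PSCDatum P) : Prop :=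
  ∀ B : Subgroup P, G.IsUnrVerticial B ↔
    ∃ (v : G.graph.V) (γ : ConjAct P),
      B = ⨅ U : {U : Subgroup P // U.Normal ∧ IsOpen (U : Set P) ∧ G.unrKer ≤ U},
        (U.1 ⊔ γ • G.vertGp v)

/-! ### The printed statements over the origin parameter -/

section Statements

variable (Ω : PSCOrigin.{u})

/-- **[IUTchI] Remark 1.2.3 (iv), verticial part, as printed**, for every sturdy `G` of PSC-type: the
characterization of the vertex quotients and of the set of vertices (the split injection
`UnrVerticialSplitInjection` and the criterion `ElementaryQuotientVerticiallyRamifiedIff` it rests on are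
`UnrVerticialCharacterizationHolds Ω` of `PSCRamification.lean`).
[cite: Mochizuki2012, IUTchI Rmk 1.2.3(iv) p.42] -/
def VertexSetCharacterizationHolds : Prop :=
  ∀ ⦃Q : Type u⦄ [Group Q] [TopologicalSpace Q] [IsTopologicalGroup Q] (G : PSCDatum Q),
    Ω.IsOfPSCType G → G.VertexQuotientCharacterization ∧ G.VertexSetCharacterization

end Statements

end PSCDatum

end Literature.AnabelianGeometry.SemiGraphs

end
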